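import Summits.CriticalPhenomena.PercolationContinuityZ3.Theorems.Transplant.FKConnectivityAllQAntipodalOrAttTStep
import Summits.CriticalPhenomena.PercolationContinuityZ3.Theorems.Transplant.FKConnectivityAllQAntipodalOrAttTInputs
import Summits.CriticalPhenomena.PercolationContinuityZ3.Theorems.Transplant.FKConnectivityAllQAntipodalOrAttTSeries
import Summits.CriticalPhenomena.PercolationContinuityZ3.Theorems.Transplant.FKConnectivityAllQAntipodalOrAttTSeriesSame
import Summits.CriticalPhenomena.PercolationContinuityZ3.Theorems.Transplant.FKConnectivityAllQAntipodalOrAttTParallel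
import HarnessLib

/-!
# Connectivity correlation inequalities for `φ_{w,q}`, every `q > 0` — file 63e: THE AND-ATTACHED OR DRIFT THEOREM — `O_A(N; y, z; C) ≤ 0` on every
# two-terminal series–parallel network, every cell, every ANTITONE level weight (the `q`-free inequality behind the level-4 type T1 = `x ∧ w ∧ (y ∨ z)`)

Support file (`--supports stmt-CriticalPhenomena-4575`), FK sub-lane `prim-bschramm-fk-2` (gen 29; the `A ⊇ C` version of gen 22's file 47e
`…OrAttPath`, memo FROM-fk-2-g29-BRIDGE §11); builds on p205010 (kernel theorem, internal audit signed; external expert review pending).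
No definitions, no named facts, no sorries; standard axioms.

**`FK.orAttTW_drift_nonpos_of_isTTSP`.**  `E` TTSP between `s, t`, `st ∉ E`, `N ⊆ E` (free), `A ⊆ E` (attached on the ROOT side), `C ⊆ A`
(contracted, both sides), `y ≠ z ∈ E` outside `N ∪ A`, `N ∩ A = ∅`, `w` antitone, `h` monotone on the subsets of `N` ⟹ with
`D(X | Y) = ∑_{γ ⊆ N} (w(k(γ∪X∪st)+k((N\γ)∪Y)) − w(k((N\γ)∪X∪st)+k(γ∪Y))) h(γ)`:
`O_A(N; y, z; C) := D(yzA | C) + D(zA | yC) + D(yA | zC) ≤ 0`.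
For `A = C` this is gen 22's `FK.orAttW_drift_nonpos_of_isTTSP` (the type `x ∧ (y ∨ z)`); in general it is the antipodal form of
`ω_{st} · ∏_{e ∈ A\C} ω_e · (ω_y ∨ ω_z)` — for `|A \ C| = 1` the level-4 extreme type T1 (memo §6, §11; numerically: 0 violations on all TTSP
≤ 6 edges, lab/orattT.py).  PROOF = gen 22's strong induction on `|E|` with the attached set threaded through as in gen 19/21's
`…AndGenWeightPath`, for ALL `A` simultaneously: (R) the ROOTLESS `O_A` of a smaller network is gen 22's rootless lemma when `A = C` and otherwise
the ROOTED `O_{A∖e}` of the host re-rooted at an attached edge `e ∈ A \ C` (`IsTTSP.reroot_erase`) — the induction hypothesis; (V) the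
VIRTUAL-ROOT form: root outside ⇒ IH; root `= y` / `= z` ⇒ pairing lemma + two rootless AND drifts with a general attached set; root ∈ `A` ⇒ (R);
root free ⇒ doubled-root decomposition of each drift ⇒ IH on `F \ root` + (R) with the root inserted on both sides; root deleted ⇒ IH.  Then
`cases` on the root junction of `E` with the junction lemmas `…OrAttTSeries`, `…OrAttTSeriesSame`, `…OrAttTParallel` fed by the oracles of
`…OrAttTInputs`, (V) and (R).
[cite: Grimmett2006, §1.4 eq. (1.20) (p. 15); §3.8 Thm. (3.90) (pp. 61–62); §3.9 (pp. 63–64)] [cite: Wagner2006, Thm. 5.8(d), §5.3]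
-/

noncomputable section

namespace Summit.CriticalPhenomena.PercolationContinuityZ3.Theorems

namespace FK

open SimpleGraph Literature.Probability.LatticeModels Literature.Probability.Percolation
open scoped Classical

variable {V : Type*} [Fintype V]

section OrAttTPath

/-- **THE AND-ATTACHED OR DRIFT THEOREM FOR ANTITONE LEVEL WEIGHTS** (strong induction on the size of the network; see the module docstring).
[cite: Grimmett2006, §3.8 Thm. (3.90) (pp. 61–62); §3.9 (pp. 63–64)] [cite: Wagner2006, Thm. 5.8(d), §5.3] -/
theorem orAttTW_drift_nonpos_of_isTTSP :
    ∀ (n : ℕ) {E : Finset (Sym2 V)} {s t : V} {N A C : Finset (Sym2 V)} {y z : Sym2 V}, E.card ≤ n → IsTTSP E s t → s(s, t) ∉ E →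
      N ⊆ E → A ⊆ E → C ⊆ A → y ∈ E → z ∈ E → y ≠ z → y ∉ N → z ∉ N → y ∉ A → z ∉ A → Disjoint N A →
      ∀ w : ℕ → ℝ, (∀ k : ℕ, w (k + 1) ≤ w k) →
      ∀ h : Finset (Sym2 V) → ℝ, (∀ ⦃X Y : Finset (Sym2 V)⦄, X ⊆ Y → Y ⊆ N → h X ≤ h Y) →
        ∑ γ ∈ N.powerset,
          ((w (clusterCount (↑(insert s(s, t) (γ ∪ insert y (insert z A))) : BondConfig V) ∅ + clusterCount (↑(N \ γ ∪ C) : BondConfig V) ∅) -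
            w (clusterCount (↑(insert s(s, t) (N \ γ ∪ insert y (insert z A))) : BondConfig V) ∅ + clusterCount (↑(γ ∪ C) : BondConfig V) ∅)) * h γ) +
        ∑ γ ∈ N.powerset,
          ((w (clusterCount (↑(insert s(s, t) (γ ∪ insert z A)) : BondConfig V) ∅ + clusterCount (↑(N \ γ ∪ insert y C) : BondConfig V) ∅) -
            w (clusterCount (↑(insert s(s, t) (N \ γ ∪ insert z A)) : BondConfig V) ∅ + clusterCount (↑(γ ∪ insert y C) : BondConfig V) ∅)) * h γ) +
        ∑ γ ∈ N.powerset,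
          ((w (clusterCount (↑(insert s(s, t) (γ ∪ insert y A)) : BondConfig V) ∅ + clusterCount (↑(N \ γ ∪ insert z C) : BondConfig V) ∅) -
            w (clusterCount (↑(insert s(s, t) (N \ γ ∪ insert y A)) : BondConfig V) ∅ + clusterCount (↑(γ ∪ insert z C) : BondConfig V) ∅)) * h γ) ≤ 0 := by
  intro n
  induction n with
  | zero =>
    intro E s t N A C y z hcard hE _ _ _ _ _ _ _ _ _ _ _ _ _ _ _ _
    rw [Nat.le_zero, Finset.card_eq_zero] at hcard
    obtain ⟨e, he, _⟩ := hE.left_mem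
    rw [hcard] at he
    exact absurd he (Finset.notMem_empty _)
  | succ n ih =>
    have rootless := fun {F : Finset (Sym2 V)} {u v : V} {N A C : Finset (Sym2 V)} {y z : Sym2 V} =>
      orAttT_rootless_of_ih (n := n) ih (F := F) (u := u) (v := v) (N := N) (A := A) (C := C) (y := y) (z := z)
    have virt := fun {F : Finset (Sym2 V)} {u v : V} {N A C : Finset (Sym2 V)} {y z : Sym2 V} =>
      orAttT_virt_of_ih (n := n) ih (F := F) (u := u) (v := v) (N := N) (A := A) (C := C) (y := y) (z := z)
    have contracted := fun {F : Finset (Sym2 V)} {u v : V} {N A C : Finset (Sym2 V)} {y z : Sym2 V} =>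
      orAttT_contracted_of_ih (n := n) ih (F := F) (u := u) (v := v) (N := N) (A := A) (C := C) (y := y) (z := z)
    -- the step: decompose `E` at its root
    intro E s t N A C y z hcard hE hst hN hA hCA hy hz hyz hyN hzN hyA hzA hNA w hw h hmono
    have hyN₁ : ∀ F : Finset (Sym2 V), y ∉ N ∩ F := fun F hh => hyN (Finset.mem_of_mem_inter_left hh)
    have hzN₁ : ∀ F : Finset (Sym2 V), z ∉ N ∩ F := fun F hh => hzN (Finset.mem_of_mem_inter_left hh)
    have hyA₁ : ∀ F : Finset (Sym2 V), y ∉ A ∩ F := fun F hh => hyA (Finset.mem_of_mem_inter_left hh)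
    have hzA₁ : ∀ F : Finset (Sym2 V), z ∉ A ∩ F := fun F hh => hzA (Finset.mem_of_mem_inter_left hh)
    have hNAF : ∀ F : Finset (Sym2 V), Disjoint (N ∩ F) (A ∩ F) := fun F => (orAttT_side hCA hNA (F := F)).2
    have hCAF : ∀ F : Finset (Sym2 V), C ∩ F ⊆ A ∩ F := fun F => (orAttT_side hCA hNA (F := F)).1
    have hNF : ∀ F : Finset (Sym2 V), N ∩ F ⊆ F := fun F => Finset.inter_subset_right
    have hAF : ∀ F : Finset (Sym2 V), A ∩ F ⊆ F := fun F => Finset.inter_subset_right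
    have hCF : ∀ F : Finset (Sym2 V), C ∩ F ⊆ F := fun F => Finset.inter_subset_right
    cases hE with
    | edge hst' => exact absurd (Finset.mem_singleton_self _) hst
    | @series E₁ E₂ _ m _ h₁ h₂ hd hV hs' ht' =>
      have hNeq : N = N ∩ E₁ ∪ N ∩ E₂ := by rw [← Finset.inter_union_distrib_left, Finset.inter_eq_left.2 hN]
      have hAeq : A = A ∩ E₁ ∪ A ∩ E₂ := by rw [← Finset.inter_union_distrib_left, Finset.inter_eq_left.2 hA]
      have hCeq : C = C ∩ E₁ ∪ C ∩ E₂ := by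
        rw [← Finset.inter_union_distrib_left, Finset.inter_eq_left.2 (hCA.trans hA)]
      set V₁ : Set V := {x | ∃ e ∈ E₁, x ∈ e} with hV₁
      set V₂ : Set V := {x | ∃ e ∈ E₂, x ∈ e} with hV₂
      have g₁ : ∀ e ∈ (↑E₁ : Set (Sym2 V)), ∀ x ∈ e, x ∈ V₁ := fun e he x hx => ⟨e, he, hx⟩
      have g₂ : ∀ e ∈ (↑E₂ : Set (Sym2 V)), ∀ x ∈ e, x ∈ V₂ := fun e he x hx => ⟨e, he, hx⟩
      have gS : V₁ ∩ V₂ ⊆ ({m} : Set V) := fun x hx => hV x hx.1 hx.2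
      have hsV₂ : s ∉ V₂ := fun ⟨e, he, hse⟩ => hs' e he hse
      have htV₁ : t ∉ V₁ := fun ⟨e, he, hte⟩ => ht' e he hte
      have hsm : s ≠ m := h₁.ne
      have htm : t ≠ m := h₂.ne.symm
      have hstne : s ≠ t := by
        obtain ⟨e, he, hte⟩ := h₂.right_mem
        intro hh; exact hs' e he (hh ▸ hte)
      have hc := Finset.card_union_of_disjoint hd
      have hcard₁ : E₁.card ≤ n := by
        obtain ⟨e, he, _⟩ := h₂.left_mem
        have h2pos : 0 < E₂.card := Finset.card_pos.2 ⟨e, he⟩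
        omega
      have hcard₂ : E₂.card ≤ n := by
        obtain ⟨e, he, _⟩ := h₁.left_mem
        have h1pos : 0 < E₁.card := Finset.card_pos.2 ⟨e, he⟩
        omega
      have hdN : Disjoint (N ∩ E₁) (N ∩ E₂) :=
        Finset.disjoint_of_subset_left Finset.inter_subset_right (Finset.disjoint_of_subset_right Finset.inter_subset_right hd)
      rw [hNeq] at hmono
      rw [hNeq, hAeq, hCeq]
      rcases Finset.mem_union.1 hy with hy₁ | hy₂ <;> rcases Finset.mem_union.1 hz with hz₁ | hz₂
      · -- y, z ∈ E₁
        have e1 : insert y (insert z (A ∩ E₁ ∪ A ∩ E₂)) = insert y (insert z (A ∩ E₁)) ∪ A ∩ E₂ := by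
          rw [Finset.insert_union, Finset.insert_union]
        have e2 : insert z (A ∩ E₁ ∪ A ∩ E₂) = insert z (A ∩ E₁) ∪ A ∩ E₂ := (Finset.insert_union _ _ _).symm
        have e3 : insert y (C ∩ E₁ ∪ C ∩ E₂) = insert y (C ∩ E₁) ∪ C ∩ E₂ := (Finset.insert_union _ _ _).symm
        have e4 : insert y (A ∩ E₁ ∪ A ∩ E₂) = insert y (A ∩ E₁) ∪ A ∩ E₂ := (Finset.insert_union _ _ _).symm
        have e5 : insert z (C ∩ E₁ ∪ C ∩ E₂) = insert z (C ∩ E₁) ∪ C ∩ E₂ := (Finset.insert_union _ _ _).symm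
        rw [e1, e2, e3, e4, e5]
        exact orAttTW_series_same₁_nonpos g₁ g₂ gS hsV₂ htV₁ hsm htm hstne hdN (hNF _) (hAF _) (hCF _) hy₁ hz₁ (hNF _) (hAF _)
          (hCF _)
          (fun w' hw' h' hm' => virt hcard₁ h₁ (hNF _) (hAF _) (hCAF _) hy₁ hz₁ hyz (hyN₁ _) (hzN₁ _) (hyA₁ _) (hzA₁ _) (hNAF _)
            w' hw' h' hm')
          (fun w' hw' h' hm' => rootless hcard₁ h₁ (hNF _) ((hAF _).trans (Finset.subset_insert _ _)) (hCAF _)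
            (Finset.mem_insert_of_mem hy₁) (Finset.mem_insert_of_mem hz₁) hyz (hyN₁ _) (hzN₁ _) (hyA₁ _) (hzA₁ _) (hNAF _)
            w' hw' h' hm')
          (orAttT_inP h₂ hCA hNA) (orAttT_inPV h₂ hCA hNA) hw hmono
      · -- y ∈ E₁, z ∈ E₂: the separating junction
        have e1 : insert y (insert z (A ∩ E₁ ∪ A ∩ E₂)) = insert y (A ∩ E₁) ∪ insert z (A ∩ E₂) := by
          rw [Finset.insert_union, Finset.union_insert]
        have e2 : insert z (A ∩ E₁ ∪ A ∩ E₂) = A ∩ E₁ ∪ insert z (A ∩ E₂) := (Finset.union_insert _ _ _).symm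
        have e3 : insert y (C ∩ E₁ ∪ C ∩ E₂) = insert y (C ∩ E₁) ∪ C ∩ E₂ := (Finset.insert_union _ _ _).symm
        have e4 : insert y (A ∩ E₁ ∪ A ∩ E₂) = insert y (A ∩ E₁) ∪ A ∩ E₂ := (Finset.insert_union _ _ _).symm
        have e5 : insert z (C ∩ E₁ ∪ C ∩ E₂) = C ∩ E₁ ∪ insert z (C ∩ E₂) := (Finset.union_insert _ _ _).symm
        rw [e1, e2, e3, e4, e5]
        exact orAttTW_series_split_nonpos g₁ g₂ gS hsV₂ htV₁ hsm htm hstne hdN (hNF _) (hAF _) (hCF _) hy₁ (hyN₁ _) (hNF _) (hAF _)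
          (hCF _) hz₂ (hzN₁ _) (orAttT_inU h₁ hy₁ hyA hCA hNA) (orAttT_inV h₁ hy₁ hyA hCA hNA) (orAttT_inA h₁ hy₁ hyN hCA hNA)
          (orAttT_inR h₁ hy₁ hyN hCA hNA) (orAttT_inU h₂ hz₂ hzA hCA hNA) (orAttT_inV h₂ hz₂ hzA hCA hNA) (orAttT_inA h₂ hz₂ hzN hCA hNA)
          (orAttT_inR h₂ hz₂ hzN hCA hNA) hw hmono
      · -- y ∈ E₂, z ∈ E₁: the separating junction with the roles of y and z exchanged
        have e1 : insert y (insert z (A ∩ E₁ ∪ A ∩ E₂)) = insert z (A ∩ E₁) ∪ insert y (A ∩ E₂) := by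
          rw [Finset.insert_comm, Finset.insert_union, Finset.union_insert]
        have e2 : insert z (A ∩ E₁ ∪ A ∩ E₂) = insert z (A ∩ E₁) ∪ A ∩ E₂ := (Finset.insert_union _ _ _).symm
        have e3 : insert y (C ∩ E₁ ∪ C ∩ E₂) = C ∩ E₁ ∪ insert y (C ∩ E₂) := (Finset.union_insert _ _ _).symm
        have e4 : insert y (A ∩ E₁ ∪ A ∩ E₂) = A ∩ E₁ ∪ insert y (A ∩ E₂) := (Finset.union_insert _ _ _).symm
        have e5 : insert z (C ∩ E₁ ∪ C ∩ E₂) = insert z (C ∩ E₁) ∪ C ∩ E₂ := (Finset.insert_union _ _ _).symm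
        rw [e1, e2, e3, e4, e5]
        have key := orAttTW_series_split_nonpos g₁ g₂ gS hsV₂ htV₁ hsm htm hstne hdN (hNF _) (hAF _) (hCF _) hz₁ (hzN₁ _) (hNF _)
          (hAF _) (hCF _) hy₂ (hyN₁ _) (orAttT_inU h₁ hz₁ hzA hCA hNA) (orAttT_inV h₁ hz₁ hzA hCA hNA) (orAttT_inA h₁ hz₁ hzN hCA hNA)
          (orAttT_inR h₁ hz₁ hzN hCA hNA) (orAttT_inU h₂ hy₂ hyA hCA hNA) (orAttT_inV h₂ hy₂ hyA hCA hNA) (orAttT_inA h₂ hy₂ hyN hCA hNA)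
          (orAttT_inR h₂ hy₂ hyN hCA hNA) hw hmono
        linarith
      · -- y, z ∈ E₂
        have e1 : insert y (insert z (A ∩ E₁ ∪ A ∩ E₂)) = A ∩ E₁ ∪ insert y (insert z (A ∩ E₂)) := by
          rw [Finset.union_insert, Finset.union_insert]
        have e2 : insert z (A ∩ E₁ ∪ A ∩ E₂) = A ∩ E₁ ∪ insert z (A ∩ E₂) := (Finset.union_insert _ _ _).symm
        have e3 : insert y (C ∩ E₁ ∪ C ∩ E₂) = C ∩ E₁ ∪ insert y (C ∩ E₂) := (Finset.union_insert _ _ _).symm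
        have e4 : insert y (A ∩ E₁ ∪ A ∩ E₂) = A ∩ E₁ ∪ insert y (A ∩ E₂) := (Finset.union_insert _ _ _).symm
        have e5 : insert z (C ∩ E₁ ∪ C ∩ E₂) = C ∩ E₁ ∪ insert z (C ∩ E₂) := (Finset.union_insert _ _ _).symm
        rw [e1, e2, e3, e4, e5]
        exact orAttTW_series_same₂_nonpos g₁ g₂ gS hsV₂ htV₁ hsm htm hstne hdN (hNF _) (hAF _) (hCF _) (hNF _) (hAF _) (hCF _)
          hy₂ hz₂ (orAttT_inP h₁ hCA hNA) (orAttT_inPV h₁ hCA hNA)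
          (fun w' hw' h' hm' => virt hcard₂ h₂ (hNF _) (hAF _) (hCAF _) hy₂ hz₂ hyz (hyN₁ _) (hzN₁ _) (hyA₁ _) (hzA₁ _) (hNAF _)
            w' hw' h' hm')
          (fun w' hw' h' hm' => rootless hcard₂ h₂ (hNF _) ((hAF _).trans (Finset.subset_insert _ _)) (hCAF _)
            (Finset.mem_insert_of_mem hy₂) (Finset.mem_insert_of_mem hz₂) hyz (hyN₁ _) (hzN₁ _) (hyA₁ _) (hzA₁ _) (hNAF _)
            w' hw' h' hm')
          hw hmono
    | @parallel E₁ E₂ _ _ h₁ h₂ hd hV =>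
      set V₁ : Set V := {x | ∃ e ∈ E₁, x ∈ e} with hV₁
      set V₂ : Set V := {x | ∃ e ∈ E₂, x ∈ e} with hV₂
      have g₁ : ∀ e ∈ (↑E₁ : Set (Sym2 V)), ∀ x ∈ e, x ∈ V₁ := fun e he x hx => ⟨e, he, hx⟩
      have g₂ : ∀ e ∈ (↑E₂ : Set (Sym2 V)), ∀ x ∈ e, x ∈ V₂ := fun e he x hx => ⟨e, he, hx⟩
      have gS : V₁ ∩ V₂ ⊆ ({s, t} : Set V) := by
        intro x hx
        rcases hV x hx.1 hx.2 with h' | h'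
        · exact Or.inl h'
        · exact Or.inr h'
      have gS' : V₂ ∩ V₁ ⊆ ({s, t} : Set V) := fun x hx => gS ⟨hx.2, hx.1⟩
      have hstne : s ≠ t := h₁.ne
      have hE₁ : E₁ ⊆ E₁ ∪ E₂ := Finset.subset_union_left
      have hE₂ : E₂ ⊆ E₁ ∪ E₂ := Finset.subset_union_right
      have hst₁ : s(s, t) ∉ E₁ := fun hh => hst (hE₁ hh)
      have hst₂ : s(s, t) ∉ E₂ := fun hh => hst (hE₂ hh)
      have hc := Finset.card_union_of_disjoint hd
      have hcard₁ : E₁.card ≤ n := by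
        obtain ⟨e, he, _⟩ := h₂.left_mem
        have h2pos : 0 < E₂.card := Finset.card_pos.2 ⟨e, he⟩
        omega
      have hcard₂ : E₂.card ≤ n := by
        obtain ⟨e, he, _⟩ := h₁.left_mem
        have h1pos : 0 < E₁.card := Finset.card_pos.2 ⟨e, he⟩
        omega
      have hdN : Disjoint (N ∩ E₁) (N ∩ E₂) :=
        Finset.disjoint_of_subset_left Finset.inter_subset_right (Finset.disjoint_of_subset_right Finset.inter_subset_right hd)
      rcases Finset.mem_union.1 hy with hy₁ | hy₂ <;> rcases Finset.mem_union.1 hz with hz₁ | hz₂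
      · -- y, z ∈ E₁
        have hNeq : N = N ∩ E₁ ∪ N ∩ E₂ := by rw [← Finset.inter_union_distrib_left, Finset.inter_eq_left.2 hN]
        have hAeq : A = A ∩ E₁ ∪ A ∩ E₂ := by rw [← Finset.inter_union_distrib_left, Finset.inter_eq_left.2 hA]
        have hCeq : C = C ∩ E₁ ∪ C ∩ E₂ := by
          rw [← Finset.inter_union_distrib_left, Finset.inter_eq_left.2 (hCA.trans hA)]
        rw [hNeq] at hmono
        rw [hNeq, hAeq, hCeq]
        have e1 : insert y (insert z (A ∩ E₁ ∪ A ∩ E₂)) = insert y (insert z (A ∩ E₁)) ∪ A ∩ E₂ := by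
          rw [Finset.insert_union, Finset.insert_union]
        have e2 : insert z (A ∩ E₁ ∪ A ∩ E₂) = insert z (A ∩ E₁) ∪ A ∩ E₂ := (Finset.insert_union _ _ _).symm
        have e3 : insert y (C ∩ E₁ ∪ C ∩ E₂) = insert y (C ∩ E₁) ∪ C ∩ E₂ := (Finset.insert_union _ _ _).symm
        have e4 : insert y (A ∩ E₁ ∪ A ∩ E₂) = insert y (A ∩ E₁) ∪ A ∩ E₂ := (Finset.insert_union _ _ _).symm
        have e5 : insert z (C ∩ E₁ ∪ C ∩ E₂) = insert z (C ∩ E₁) ∪ C ∩ E₂ := (Finset.insert_union _ _ _).symm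
        rw [e1, e2, e3, e4, e5]
        exact orAttTW_parallel_same_nonpos g₁ g₂ gS hstne hdN (hNF _) (hAF _) (hCF _) hy₁ hz₁ (hNF _) (hAF _) (hCF _)
          (fun w' hw' h' hm' => ih hcard₁ h₁ hst₁ (hNF _) (hAF _) (hCAF _) hy₁ hz₁ hyz (hyN₁ _) (hzN₁ _) (hyA₁ _) (hzA₁ _)
            (hNAF _) w' hw' h' hm')
          (fun w' hw' h' hm' => contracted hcard₁ h₁ hst₁ (hNF _) (hAF _) (hCAF _) hy₁ hz₁ hyz (hyN₁ _) (hzN₁ _) (hyA₁ _)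
            (hzA₁ _) (hNAF _) w' hw' h' hm')
          (orAttT_inP h₂ hCA hNA) (orAttT_inL₀ hst₂ h₂ hCA hNA) hw hmono
      · -- y ∈ E₁, z ∈ E₂: the separating junction
        have hNeq : N = N ∩ E₁ ∪ N ∩ E₂ := by rw [← Finset.inter_union_distrib_left, Finset.inter_eq_left.2 hN]
        have hAeq : A = A ∩ E₁ ∪ A ∩ E₂ := by rw [← Finset.inter_union_distrib_left, Finset.inter_eq_left.2 hA]
        have hCeq : C = C ∩ E₁ ∪ C ∩ E₂ := by
          rw [← Finset.inter_union_distrib_left, Finset.inter_eq_left.2 (hCA.trans hA)]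
        rw [hNeq] at hmono
        rw [hNeq, hAeq, hCeq]
        have e1 : insert y (insert z (A ∩ E₁ ∪ A ∩ E₂)) = insert y (A ∩ E₁) ∪ insert z (A ∩ E₂) := by
          rw [Finset.insert_union, Finset.union_insert]
        have e2 : insert z (A ∩ E₁ ∪ A ∩ E₂) = A ∩ E₁ ∪ insert z (A ∩ E₂) := (Finset.union_insert _ _ _).symm
        have e3 : insert y (C ∩ E₁ ∪ C ∩ E₂) = insert y (C ∩ E₁) ∪ C ∩ E₂ := (Finset.insert_union _ _ _).symm
        have e4 : insert y (A ∩ E₁ ∪ A ∩ E₂) = insert y (A ∩ E₁) ∪ A ∩ E₂ := (Finset.insert_union _ _ _).symm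
        have e5 : insert z (C ∩ E₁ ∪ C ∩ E₂) = C ∩ E₁ ∪ insert z (C ∩ E₂) := (Finset.union_insert _ _ _).symm
        rw [e1, e2, e3, e4, e5]
        exact orAttTW_parallel_split_nonpos g₁ g₂ gS hstne hdN (hNF _) (hAF _) (hCF _) hy₁ (hyN₁ _) (hNF _) (hAF _) (hCF _) hz₂
          (hzN₁ _) (orAttT_inU h₁ hy₁ hyA hCA hNA) (orAttT_inL hst₁ h₁ hy₁ hyA hCA hNA) (orAttT_inA h₁ hy₁ hyN hCA hNA)
          (orAttT_inK hst₁ h₁ hy₁ hyN hCA hNA) (orAttT_inU h₂ hz₂ hzA hCA hNA) (orAttT_inL hst₂ h₂ hz₂ hzA hCA hNA)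
          (orAttT_inA h₂ hz₂ hzN hCA hNA) (orAttT_inK hst₂ h₂ hz₂ hzN hCA hNA) hw hmono
      · -- y ∈ E₂, z ∈ E₁: the separating junction with the roles of y and z exchanged
        have hNeq : N = N ∩ E₁ ∪ N ∩ E₂ := by rw [← Finset.inter_union_distrib_left, Finset.inter_eq_left.2 hN]
        have hAeq : A = A ∩ E₁ ∪ A ∩ E₂ := by rw [← Finset.inter_union_distrib_left, Finset.inter_eq_left.2 hA]
        have hCeq : C = C ∩ E₁ ∪ C ∩ E₂ := by
          rw [← Finset.inter_union_distrib_left, Finset.inter_eq_left.2 (hCA.trans hA)]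
        rw [hNeq] at hmono
        rw [hNeq, hAeq, hCeq]
        have e1 : insert y (insert z (A ∩ E₁ ∪ A ∩ E₂)) = insert z (A ∩ E₁) ∪ insert y (A ∩ E₂) := by
          rw [Finset.insert_comm, Finset.insert_union, Finset.union_insert]
        have e2 : insert z (A ∩ E₁ ∪ A ∩ E₂) = insert z (A ∩ E₁) ∪ A ∩ E₂ := (Finset.insert_union _ _ _).symm
        have e3 : insert y (C ∩ E₁ ∪ C ∩ E₂) = C ∩ E₁ ∪ insert y (C ∩ E₂) := (Finset.union_insert _ _ _).symm
        have e4 : insert y (A ∩ E₁ ∪ A ∩ E₂) = A ∩ E₁ ∪ insert y (A ∩ E₂) := (Finset.union_insert _ _ _).symm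
        have e5 : insert z (C ∩ E₁ ∪ C ∩ E₂) = insert z (C ∩ E₁) ∪ C ∩ E₂ := (Finset.insert_union _ _ _).symm
        rw [e1, e2, e3, e4, e5]
        have key := orAttTW_parallel_split_nonpos g₁ g₂ gS hstne hdN (hNF _) (hAF _) (hCF _) hz₁ (hzN₁ _) (hNF _) (hAF _) (hCF _)
          hy₂ (hyN₁ _) (orAttT_inU h₁ hz₁ hzA hCA hNA) (orAttT_inL hst₁ h₁ hz₁ hzA hCA hNA) (orAttT_inA h₁ hz₁ hzN hCA hNA)
          (orAttT_inK hst₁ h₁ hz₁ hzN hCA hNA) (orAttT_inU h₂ hy₂ hyA hCA hNA) (orAttT_inL hst₂ h₂ hy₂ hyA hCA hNA)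
          (orAttT_inA h₂ hy₂ hyN hCA hNA) (orAttT_inK hst₂ h₂ hy₂ hyN hCA hNA) hw hmono
        linarith
      · -- y, z ∈ E₂: the one-sided junction with the sides exchanged
        have hNeq : N = N ∩ E₂ ∪ N ∩ E₁ := by
          rw [← Finset.inter_union_distrib_left, Finset.union_comm, Finset.inter_eq_left.2 hN]
        have hAeq : A = A ∩ E₂ ∪ A ∩ E₁ := by
          rw [← Finset.inter_union_distrib_left, Finset.union_comm, Finset.inter_eq_left.2 hA]
        have hCeq : C = C ∩ E₂ ∪ C ∩ E₁ := by
          rw [← Finset.inter_union_distrib_left, Finset.union_comm, Finset.inter_eq_left.2 (hCA.trans hA)]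
        rw [hNeq] at hmono
        rw [hNeq, hAeq, hCeq]
        have e1 : insert y (insert z (A ∩ E₂ ∪ A ∩ E₁)) = insert y (insert z (A ∩ E₂)) ∪ A ∩ E₁ := by
          rw [Finset.insert_union, Finset.insert_union]
        have e2 : insert z (A ∩ E₂ ∪ A ∩ E₁) = insert z (A ∩ E₂) ∪ A ∩ E₁ := (Finset.insert_union _ _ _).symm
        have e3 : insert y (C ∩ E₂ ∪ C ∩ E₁) = insert y (C ∩ E₂) ∪ C ∩ E₁ := (Finset.insert_union _ _ _).symm
        have e4 : insert y (A ∩ E₂ ∪ A ∩ E₁) = insert y (A ∩ E₂) ∪ A ∩ E₁ := (Finset.insert_union _ _ _).symm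
        have e5 : insert z (C ∩ E₂ ∪ C ∩ E₁) = insert z (C ∩ E₂) ∪ C ∩ E₁ := (Finset.insert_union _ _ _).symm
        rw [e1, e2, e3, e4, e5]
        exact orAttTW_parallel_same_nonpos g₂ g₁ gS' hstne hdN.symm (hNF _) (hAF _) (hCF _) hy₂ hz₂ (hNF _) (hAF _) (hCF _)
          (fun w' hw' h' hm' => ih hcard₂ h₂ hst₂ (hNF _) (hAF _) (hCAF _) hy₂ hz₂ hyz (hyN₁ _) (hzN₁ _) (hyA₁ _) (hzA₁ _)
            (hNAF _) w' hw' h' hm')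
          (fun w' hw' h' hm' => contracted hcard₂ h₂ hst₂ (hNF _) (hAF _) (hCAF _) hy₂ hz₂ hyz (hyN₁ _) (hzN₁ _) (hyA₁ _)
            (hzA₁ _) (hNAF _) w' hw' h' hm')
          (orAttT_inP h₁ hCA hNA) (orAttT_inL₀ hst₁ h₁ hCA hNA) hw hmono

end OrAttTPath

end FK

end Summit.CriticalPhenomena.PercolationContinuityZ3.Theorems

end
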